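import Summits.Ventures.LatticeQCDFlow.Scoring.SchwingerDysonFreePropagator
import HarnessLib

/-!
# The free-field oracle in spectral form from Schwinger–Dyson: `2(m² + κ)⟨(b·φ)²⟩ = ‖b‖²` for every Laplacian eigenmode `b`, and its interacting correction

HONEST FRAMING: exact (Metropolis-corrected) sampling algorithms for lattice gauge theory;
figures of merit are autocorrelation/cost numbers at stated couplings and volumes; no
continuum-physics claim.  (SCALAR calibration rung S0-A: not a gauge result.)

Venture `LatticeQCDFlow` (cell pub-lqcd), sub-topic `Scoring`; FANOUT row 2 (`s0-phi4`).  NEW WORK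
of the cell.  The exactness battery's leg T1 (BATTERY-REPORT.md v1.1, "exact free-field limit")
compares a λ = 0 chain of the engine's 2-d φ⁴ action (latflow.core `phi4_2d`, AKS 2019 eq. (3.35):
`S = Σ_x [Σ_μ (φ(x+μ) − φ_x)² + m² φ_x² + λ φ_x⁴]`) with the momentum-space propagator
`G̃(k) = ⟨|φ̃(k)|²⟩ / V = 1 / (2(m² + k̂²))`, `k̂² = Σ_μ 4 sin²(k_μ/2)`.  This file derives that
oracle — in the form valid for ANY eigenmode of the lattice Laplacian, on any finite site set with
shift bijections — from the Schwinger–Dyson identity alone (no Gaussian integral, no Fourier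
inversion), together with its exact INTERACTING correction at `λ > 0`:

* `gibbs_sd_linear_of_coercive` — `⟨(Σ_y a_y φ_y) ∂S/∂φ_x⟩ = a_x` (linear observables);
* `gibbs_sd_bilinear_of_coercive` — `⟨(a·φ) Σ_x b_x ∂S/∂φ_x⟩ = Σ_x a_x b_x`;
* `sum_mul_force_shift_of_eigen` — summation by parts: if `Σ_μ (2b_x − b(σ_μ x) − b(σ_μ⁻¹ x)) =
  κ b_x` for all `x` (`b` an eigenmode of `−Δ_lat` with eigenvalue `κ`), then
  `Σ_x b_x ∂S/∂φ_x = 2(κ + m²) (b·φ) + 4λ Σ_x b_x φ_x³`;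
* **`spectral_sd_shift_of_coercive`** / **`spectral_sd_shift`** (`λ > 0`, any real `m²`):
  `2(κ + m²) ⟨(b·φ)²⟩ + 4λ ⟨(b·φ) Σ_x b_x φ_x³⟩ = ‖b‖²` — the mode-by-mode interacting
  Schwinger–Dyson relation (a reference-free exactness relation per Fourier mode);
* **`free_spectral_oracle`** (`λ = 0`, `m² > 0`): `2(κ + m²) ⟨(b·φ)²⟩ = ‖b‖²`, and
  `free_spectral_oracle_div`: `⟨(b·φ)²⟩ = ‖b‖² / (2(κ + m²))` for `b ≠ 0`.  With `b = cos(k·x)`,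
  `sin(k·x)` on the periodic `L₀ × L₁` lattice (eigenmodes with `κ = k̂²`, `‖cos‖² + ‖sin‖² = V`)
  this is `⟨|φ̃(k)|²⟩ = V / (2(m² + k̂²))`, the T1 oracle.

NOT here: the trigonometric verification that plane waves are eigenmodes of the periodic
Laplacian (elementary, left to the instance at hand); statistical power (numerics gate).
-/

namespace Summit.Ventures.LatticeQCDFlow.Scoring

open Real MeasureTheory Set Filter Finset

section Spectral

variable {n : ℕ} {ι : Type*} [Fintype ι]

/-! ## Linear and bilinear observables -/

/-- **SD for a linear observable**, under coercivity: `⟨(Σ_y a_y φ_y) ∂S/∂φ_x⟩ = a_x`. -/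
theorem gibbs_sd_linear_of_coercive {J : Fin (n + 1) → Fin (n + 1) → ℝ} {lam ε K : ℝ}
    (hε : 0 < ε) (hS : ∀ φ : Fin (n + 1) → ℝ, ε * ∑ w, φ w ^ 2 - K ≤ latticePhi4Action J lam φ)
    (a : Fin (n + 1) → ℝ) (x : Fin (n + 1)) :
    gibbsExpect J lam (fun φ => (∑ y, a y * φ y) * latticePhi4Force J lam φ x) = a x := by
  have hI : ∀ y, Integrable (fun φ : Fin (n + 1) → ℝ =>
      φ y * latticePhi4Force J lam φ x * gibbsWeight J lam φ) := by
    intro y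
    refine (integrable_pow_mul_pow_mul_force_mul_gibbsWeight_of_coercive hε hS y y x 1 0).congr
      (Eventually.of_forall fun φ => ?_)
    simp only [pow_one, pow_zero, mul_one]
  have e : (fun φ : Fin (n + 1) → ℝ => (∑ y, a y * φ y) * latticePhi4Force J lam φ x)
      = fun φ => ∑ y, a y * (φ y * latticePhi4Force J lam φ x) := by
    funext φ
    rw [Finset.sum_mul]
    exact Finset.sum_congr rfl fun y _ => by ring
  rw [e, gibbsExpect_sum J lam Finset.univ (fun y _ => ((hI y).const_mul (a y)).congr
    (Eventually.of_forall fun φ => by dsimp only; ring))]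
  simp only [gibbsExpect_const_mul, gibbs_sd_two_point_of_coercive hε hS, mul_ite, mul_one,
    mul_zero, Finset.sum_ite_eq', Finset.mem_univ, if_true]

/-- Integrability of `(a·φ) F_x e^{−S}`. -/
theorem integrable_linear_mul_force_mul_gibbsWeight_of_coercive
    {J : Fin (n + 1) → Fin (n + 1) → ℝ} {lam ε K : ℝ} (hε : 0 < ε)
    (hS : ∀ φ : Fin (n + 1) → ℝ, ε * ∑ w, φ w ^ 2 - K ≤ latticePhi4Action J lam φ)
    (a : Fin (n + 1) → ℝ) (x : Fin (n + 1)) :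
    Integrable (fun φ : Fin (n + 1) → ℝ =>
      (∑ y, a y * φ y) * latticePhi4Force J lam φ x * gibbsWeight J lam φ) := by
  have hI : ∀ y, Integrable (fun φ : Fin (n + 1) → ℝ =>
      φ y * latticePhi4Force J lam φ x * gibbsWeight J lam φ) := by
    intro y
    refine (integrable_pow_mul_pow_mul_force_mul_gibbsWeight_of_coercive hε hS y y x 1 0).congr
      (Eventually.of_forall fun φ => ?_)
    simp only [pow_one, pow_zero, mul_one]
  refine (integrable_finsetSum Finset.univ fun y (_ : y ∈ Finset.univ) =>
    (hI y).const_mul (a y)).congr (Eventually.of_forall fun φ => ?_)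
  simp only [Finset.sum_mul]
  exact Finset.sum_congr rfl fun y _ => by ring

/-- **SD for a bilinear pairing**, under coercivity:
`⟨(Σ_y a_y φ_y) · Σ_x b_x ∂S/∂φ_x⟩ = Σ_x a_x b_x`. -/
theorem gibbs_sd_bilinear_of_coercive {J : Fin (n + 1) → Fin (n + 1) → ℝ} {lam ε K : ℝ}
    (hε : 0 < ε) (hS : ∀ φ : Fin (n + 1) → ℝ, ε * ∑ w, φ w ^ 2 - K ≤ latticePhi4Action J lam φ)
    (a b : Fin (n + 1) → ℝ) :
    gibbsExpect J lam (fun φ => (∑ y, a y * φ y) * ∑ x, b x * latticePhi4Force J lam φ x)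
      = ∑ x, a x * b x := by
  have hI := integrable_linear_mul_force_mul_gibbsWeight_of_coercive hε hS a
  have e : (fun φ : Fin (n + 1) → ℝ => (∑ y, a y * φ y) * ∑ x, b x * latticePhi4Force J lam φ x)
      = fun φ => ∑ x, b x * ((∑ y, a y * φ y) * latticePhi4Force J lam φ x) := by
    funext φ
    rw [Finset.mul_sum]
    exact Finset.sum_congr rfl fun x _ => by ring
  rw [e, gibbsExpect_sum J lam Finset.univ (fun x _ => ((hI x).const_mul (b x)).congr
    (Eventually.of_forall fun φ => by dsimp only; ring))]
  simp only [gibbsExpect_const_mul, gibbs_sd_linear_of_coercive hε hS]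
  exact Finset.sum_congr rfl fun x _ => by ring

/-! ## Summation by parts for the engine's force -/

/-- **Summation by parts against a Laplacian eigenmode.**  For the engine's action
(`J = shiftCoupling σ m²`) and `b` with `Σ_μ (2b_x − b(σ_μ x) − b(σ_μ⁻¹ x)) = κ b_x` for all `x`:
`Σ_x b_x ∂S/∂φ_x = 2(κ + m²) Σ_x b_x φ_x + 4λ Σ_x b_x φ_x³`. -/
theorem sum_mul_force_shift_of_eigen (σ : ι → Equiv.Perm (Fin (n + 1))) (m2 lam : ℝ)
    {b : Fin (n + 1) → ℝ} {κ : ℝ}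
    (hb : ∀ x, ∑ μ, (2 * b x - b (σ μ x) - b ((σ μ).symm x)) = κ * b x)
    (φ : Fin (n + 1) → ℝ) :
    ∑ x, b x * latticePhi4Force (shiftCoupling σ m2) lam φ x
      = 2 * (κ + m2) * ∑ x, b x * φ x + 4 * lam * ∑ x, b x * φ x ^ 3 := by
  simp only [latticePhi4Force_shift]
  -- re-index the shifted sums through the bijections `σ_μ`
  have h1 : ∀ μ, ∑ x, b x * φ (σ μ x) = ∑ x, b ((σ μ).symm x) * φ x := by
    intro μ
    have e := Equiv.sum_comp (σ μ) (fun x => b ((σ μ).symm x) * φ x)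
    simp only [Equiv.symm_apply_apply] at e
    exact e
  have h2 : ∀ μ, ∑ x, b x * φ ((σ μ).symm x) = ∑ x, b (σ μ x) * φ x := by
    intro μ
    have e := Equiv.sum_comp (σ μ).symm (fun x => b (σ μ x) * φ x)
    simp only [Equiv.apply_symm_apply] at e
    exact e
  have hkin : ∑ x, b x * ∑ μ, (4 * φ x - 2 * φ (σ μ x) - 2 * φ ((σ μ).symm x))
      = 2 * κ * ∑ x, b x * φ x := by
    have s1 : ∑ x, b x * ∑ μ, (4 * φ x - 2 * φ (σ μ x) - 2 * φ ((σ μ).symm x))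
        = ∑ μ, ((4 * ∑ x, b x * φ x) - 2 * (∑ x, b x * φ (σ μ x))
            - 2 * ∑ x, b x * φ ((σ μ).symm x)) := by
      simp only [Finset.mul_sum]
      rw [Finset.sum_comm]
      refine Finset.sum_congr rfl fun μ _ => ?_
      rw [← Finset.sum_sub_distrib, ← Finset.sum_sub_distrib]
      exact Finset.sum_congr rfl fun x _ => by ring
    have s2 : ∀ μ, (4 * ∑ x, b x * φ x) - 2 * (∑ x, b x * φ (σ μ x))
          - 2 * ∑ x, b x * φ ((σ μ).symm x)
        = ∑ x, (4 * b x - 2 * b ((σ μ).symm x) - 2 * b (σ μ x)) * φ x := by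
      intro μ
      rw [h1, h2, Finset.mul_sum, Finset.mul_sum, Finset.mul_sum, ← Finset.sum_sub_distrib,
        ← Finset.sum_sub_distrib]
      exact Finset.sum_congr rfl fun x _ => by ring
    have s3 : ∑ μ, ∑ x, (4 * b x - 2 * b ((σ μ).symm x) - 2 * b (σ μ x)) * φ x
        = ∑ x, (2 * ∑ μ, (2 * b x - b (σ μ x) - b ((σ μ).symm x))) * φ x := by
      rw [Finset.sum_comm]
      refine Finset.sum_congr rfl fun x _ => ?_
      rw [Finset.mul_sum, Finset.sum_mul]
      exact Finset.sum_congr rfl fun μ _ => by ring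
    rw [s1, Finset.sum_congr rfl fun μ _ => s2 μ, s3]
    calc ∑ x, (2 * ∑ μ, (2 * b x - b (σ μ x) - b ((σ μ).symm x))) * φ x
        = ∑ x, 2 * κ * (b x * φ x) := Finset.sum_congr rfl fun x _ => by rw [hb x]; ring
      _ = 2 * κ * ∑ x, b x * φ x := by rw [Finset.mul_sum]
  have e : ∑ x, b x * ((∑ μ, (4 * φ x - 2 * φ (σ μ x) - 2 * φ ((σ μ).symm x)))
      + 2 * m2 * φ x + 4 * lam * φ x ^ 3)
      = (∑ x, b x * ∑ μ, (4 * φ x - 2 * φ (σ μ x) - 2 * φ ((σ μ).symm x)))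
        + 2 * m2 * (∑ x, b x * φ x) + 4 * lam * ∑ x, b x * φ x ^ 3 := by
    rw [Finset.mul_sum, Finset.mul_sum, ← Finset.sum_add_distrib, ← Finset.sum_add_distrib]
    exact Finset.sum_congr rfl fun x _ => by ring
  rw [e, hkin]
  ring

/-! ## The spectral Schwinger–Dyson relation and the free-field oracle -/

/-- **Mode-by-mode Schwinger–Dyson relation, coercive form.**  For the engine's action, any real
`λ`, `m²` with `εΣφ² − K ≤ S`, and any eigenmode `b` of `−Δ_lat` (eigenvalue `κ`):
`2(κ + m²) ⟨(b·φ)²⟩ + 4λ ⟨(b·φ) Σ_x b_x φ_x³⟩ = Σ_x b_x²`. -/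
theorem spectral_sd_shift_of_coercive (σ : ι → Equiv.Perm (Fin (n + 1))) {m2 lam ε K : ℝ}
    (hε : 0 < ε)
    (hS : ∀ φ : Fin (n + 1) → ℝ,
      ε * ∑ w, φ w ^ 2 - K ≤ latticePhi4Action (shiftCoupling σ m2) lam φ)
    {b : Fin (n + 1) → ℝ} {κ : ℝ}
    (hb : ∀ x, ∑ μ, (2 * b x - b (σ μ x) - b ((σ μ).symm x)) = κ * b x) :
    2 * (κ + m2) * gibbsExpect (shiftCoupling σ m2) lam (fun φ => (∑ y, b y * φ y) ^ 2)
        + 4 * lam * gibbsExpect (shiftCoupling σ m2) lam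
            (fun φ => (∑ y, b y * φ y) * ∑ x, b x * φ x ^ 3)
      = ∑ x, b x ^ 2 := by
  set J := shiftCoupling σ m2 with hJ
  have hbil := gibbs_sd_bilinear_of_coercive hε hS b b
  have e : (fun φ : Fin (n + 1) → ℝ => (∑ y, b y * φ y) * ∑ x, b x * latticePhi4Force J lam φ x)
      = fun φ => 2 * (κ + m2) * (∑ y, b y * φ y) ^ 2
          + 4 * lam * ((∑ y, b y * φ y) * ∑ x, b x * φ x ^ 3) := by
    funext φ
    rw [hJ, sum_mul_force_shift_of_eigen σ m2 lam hb φ]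
    ring
  -- integrability of the two quadratic observables
  have hI2 : ∀ y z (c : ℕ), Integrable (fun φ : Fin (n + 1) → ℝ =>
      φ y * φ z ^ c * gibbsWeight J lam φ) := by
    intro y z c
    refine (integrable_pow_mul_pow_mul_gibbsWeight_of_coercive hε hS y z 1 c).congr
      (Eventually.of_forall fun φ => ?_)
    simp only [pow_one]
  have hIq : ∀ c : ℕ, Integrable (fun φ : Fin (n + 1) → ℝ =>
      (∑ y, b y * φ y) * (∑ x, b x * φ x ^ c) * gibbsWeight J lam φ) := by
    intro c
    have e2 : (fun φ : Fin (n + 1) → ℝ =>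
        (∑ y, b y * φ y) * (∑ x, b x * φ x ^ c) * gibbsWeight J lam φ)
        = fun φ => ∑ y, ∑ x, b y * b x * (φ y * φ x ^ c * gibbsWeight J lam φ) := by
      funext φ
      rw [Finset.sum_mul, Finset.sum_mul]
      refine Finset.sum_congr rfl fun y _ => ?_
      rw [Finset.mul_sum, Finset.sum_mul]
      exact Finset.sum_congr rfl fun x _ => by ring
    rw [e2]
    exact integrable_finsetSum Finset.univ fun y _ =>
      integrable_finsetSum Finset.univ fun x _ => (hI2 y x c).const_mul (b y * b x)
  have hA : Integrable (fun φ : Fin (n + 1) → ℝ =>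
      2 * (κ + m2) * (∑ y, b y * φ y) ^ 2 * gibbsWeight J lam φ) := by
    refine ((hIq 1).const_mul (2 * (κ + m2))).congr (Eventually.of_forall fun φ => ?_)
    simp only [pow_one, sq]
    ring
  have hB : Integrable (fun φ : Fin (n + 1) → ℝ =>
      4 * lam * ((∑ y, b y * φ y) * ∑ x, b x * φ x ^ 3) * gibbsWeight J lam φ) := by
    refine ((hIq 3).const_mul (4 * lam)).congr (Eventually.of_forall fun φ => ?_)
    ring
  rw [e, gibbsExpect_add J lam hA hB, gibbsExpect_const_mul, gibbsExpect_const_mul] at hbil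
  rw [hbil]
  exact Finset.sum_congr rfl fun x _ => by ring

/-- **Mode-by-mode Schwinger–Dyson relation for the engine's action**, `λ > 0`, ANY real `m²`
(incl. the tachyonic AKS 2019 sets `m² = −4`), any eigenmode `b` of `−Δ_lat` with eigenvalue `κ`:
`2(κ + m²) ⟨(b·φ)²⟩ + 4λ ⟨(b·φ) Σ_x b_x φ_x³⟩ = ‖b‖²`.  For plane waves: an exact relation
between the measured structure factor `⟨|φ̃(k)|²⟩` and the measured `φ̃(k)–φ̃³(k)` pairing. -/
theorem spectral_sd_shift {lam : ℝ} (hlam : 0 < lam) (σ : ι → Equiv.Perm (Fin (n + 1)))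
    (m2 : ℝ) {b : Fin (n + 1) → ℝ} {κ : ℝ}
    (hb : ∀ x, ∑ μ, (2 * b x - b (σ μ x) - b ((σ μ).symm x)) = κ * b x) :
    2 * (κ + m2) * gibbsExpect (shiftCoupling σ m2) lam (fun φ => (∑ y, b y * φ y) ^ 2)
        + 4 * lam * gibbsExpect (shiftCoupling σ m2) lam
            (fun φ => (∑ y, b y * φ y) * ∑ x, b x * φ x ^ 3)
      = ∑ x, b x ^ 2 :=
  spectral_sd_shift_of_coercive σ one_pos (latticePhi4Action_coercive hlam _) hb

/-- **The free-field oracle in spectral form** (`λ = 0`, `m² > 0`): for every eigenmode `b` of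
`−Δ_lat` with eigenvalue `κ`, `2(κ + m²) ⟨(b·φ)²⟩ = ‖b‖²`.  With `b = cos(k·x), sin(k·x)` on the
periodic lattice (`κ = k̂² = Σ_μ 4 sin²(k_μ/2)`, `‖cos‖² + ‖sin‖² = V`):
`⟨|φ̃(k)|²⟩ = V / (2(m² + k̂²))`, i.e. the battery's `G̃(k) = 1/(2(m² + k̂²))`. -/
theorem free_spectral_oracle (σ : ι → Equiv.Perm (Fin (n + 1))) {m2 : ℝ} (hm2 : 0 < m2)
    {b : Fin (n + 1) → ℝ} {κ : ℝ}
    (hb : ∀ x, ∑ μ, (2 * b x - b (σ μ x) - b ((σ μ).symm x)) = κ * b x) :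
    2 * (κ + m2) * gibbsExpect (shiftCoupling σ m2) 0 (fun φ => (∑ y, b y * φ y) ^ 2)
      = ∑ x, b x ^ 2 := by
  have h := spectral_sd_shift_of_coercive σ hm2
    (shiftCoupling_coercive_of_pos_mass σ (m2 := m2) le_rfl) hb (lam := 0)
  simpa using h

/-- **Division form**: for a nonzero eigenmode, `κ + m² ≠ 0` follows from the identity itself, and
`⟨(b·φ)²⟩ = ‖b‖² / (2(κ + m²))`. -/
theorem free_spectral_oracle_div (σ : ι → Equiv.Perm (Fin (n + 1))) {m2 : ℝ} (hm2 : 0 < m2)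
    {b : Fin (n + 1) → ℝ} {κ : ℝ}
    (hb : ∀ x, ∑ μ, (2 * b x - b (σ μ x) - b ((σ μ).symm x)) = κ * b x)
    (hb0 : ∃ x, b x ≠ 0) :
    gibbsExpect (shiftCoupling σ m2) 0 (fun φ => (∑ y, b y * φ y) ^ 2)
      = (∑ x, b x ^ 2) / (2 * (κ + m2)) := by
  have h := free_spectral_oracle σ hm2 hb
  obtain ⟨x0, hx0⟩ := hb0
  have hpos : 0 < ∑ x, b x ^ 2 :=
    lt_of_lt_of_le (by positivity) (Finset.single_le_sum (f := fun x => b x ^ 2)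
      (fun x _ => sq_nonneg (b x)) (Finset.mem_univ x0))
  have hne : 2 * (κ + m2) ≠ 0 := by
    intro h0
    rw [h0, zero_mul] at h
    linarith
  rw [eq_div_iff hne, mul_comm]
  exact h

end Spectral

end Summit.Ventures.LatticeQCDFlow.Scoring
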